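import Mathlib
import HarnessLib
import Literature.Geometry.DiscreteGeometry.KissingPatterns
import Literature.Probability.Process.PointStationaryLaw
import Summits.AtomisticToContinuum.Crystallization.Theorems.FrustratedLawDichotomyTextureFineShells

/-!
# Crux `AperiodicFrustratedLawGap` — TEXTURE TRANSFER II: the charged configuration is everywhere frustrated

Route `FrustratedLawDichotomy` (and `PeriodicChargeSplit`), crux `AperiodicFrustratedLawGap` (item
`stmt-AtomisticToContinuum-27623`), skeleton `dd3251ad731e`; hand-1 lane, generation 4; companion of
`FrustratedLawDichotomyTextureFineShells` (p800350).  Clause (2) of the texture («ALL-1/20-BAD»: no site of the `R`-ball of a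
finite approximant has its `13/10`-shell, rescaled by the nearest-neighbour distance and rotated by a linear isometry,
bijectively within `1/20` of the fcc or hcp kissing pattern) is the FRUSTRATION hypothesis of the crux.  Badness is not
closed under the two-way `ε`-matching of clause (d) (tolerance exactly `1/20`, atoms on the shell sphere `13/10·d`), so
it reaches the charged configuration `μ` only in ROBUST form: `good_transfer_core` (engine, any pattern of unit vectors
pairwise `≥ 1` apart: a ROBUSTLY GOOD atom of `S` — scale `d` = nearest-neighbour distance, isometry `A`, shell atoms
`t u` with `‖(t u − p) − d•A u‖ ≤ η·d`, `η < 1/20`, and a SHELL GAP `γ > 0` (every atom `s ≠ p` with `dist s p < 13/10·d + γ`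
has `dist s p ≤ 13/10·d − γ` and is some `t u`) — makes the matched site of every fine enough two-way matched
`7/10`-separated approximant `1/20`-good, by an explicit bijection shell ≃ pattern, `Equiv.ofBijective` of the matching);
`not_robustGood_of_texture` (deterministic: a texture-charged rooted hard-core configuration has NO robustly good atom,
fcc or hcp; only separation, clause (2) and the matching clauses of (d) are used); `ae_not_robustGood_of_texture` (law
level, the crux's `let`-bound `Gy`/`TexBall`/`Appr` VERBATIM: clauses (a) + (d) give it almost surely at every atom).
The boundary cases left open (tolerance exactly `1/20`, atoms on the sphere `13/10·d`) are exactly those clause (d) does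
not decide.  `[folklore]` (elementary metric bookkeeping; no literature content).
-/

noncomputable section

namespace Summit.AtomisticToContinuum.Crystallization.Theorems.FrustratedLawDichotomyTextureAllBad

open MeasureTheory Literature.Probability.Process Literature.Geometry.DiscreteGeometry
open Summit.AtomisticToContinuum.Crystallization.Theorems.FrustratedLawDichotomyTextureFineShells
  (norm_sub_smul_eq fccKissingPattern_nonempty hcpKissingPattern_nonempty)

/-- **Goodness-transfer engine.**  See the module docstring: a robustly good atom `p` of the separated set `S` (scale `d`,
isometry `A`, shell atoms `t u`, tolerance `η < 1/20`, shell gap `γ`) makes the matched site `j` of any fine enough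
two-way matched `7/10`-separated approximant `y` (radius `R ≥ 2d + γ + 2`, tolerance `ε` with `100ε ≤ d(1 − 20η)`, `5ε ≤ γ`,
`4ε < δ`) `1/20`-good for the same pattern: there is a bijection `e` from the punctured `13/10·d_j`-shell of `y j` onto
`Pat` with `dist (d_j⁻¹•(z − y j)) (A (e z)) ≤ 1/20`, `d_j` the nearest-neighbour distance of `j`. [folklore] -/
theorem good_transfer_core {S : Set (EuclideanSpace ℝ (Fin 3))} {δ : ℝ}
    (hS : ∀ x ∈ S, ∀ x' ∈ S, x ≠ x' → δ ≤ dist x x')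
    {N : ℕ} {y : Fin N → EuclideanSpace ℝ (Fin 3)} {i j : Fin N} {p : EuclideanSpace ℝ (Fin 3)} {R ε : ℝ}
    (hsepY : ∀ a b : Fin N, a ≠ b → (7 : ℝ) / 10 ≤ dist (y a) (y b))
    (hm1 : ∀ s ∈ S, dist s p ≤ R → ∃ a : Fin N, dist (y a - y i) (s - p) ≤ ε)
    (hm2 : ∀ a : Fin N, dist (y a) (y i) ≤ R → ∃ s ∈ S, dist (y a - y i) (s - p) ≤ ε)
(hp : p ∈ S) (hj : dist (y j - y i) (p - p) ≤ ε)
    {Pat : Finset (EuclideanSpace ℝ (Fin 3))} (hPat : Pat.Nonempty) (hPatn : ∀ u ∈ Pat, ‖u‖ = 1)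
    (hPat1 : ∀ u ∈ Pat, ∀ u' ∈ Pat, u ≠ u' → 1 ≤ dist u u')
    {d η γ : ℝ} {A : EuclideanSpace ℝ (Fin 3) →ₗᵢ[ℝ] EuclideanSpace ℝ (Fin 3)} {t : ↥Pat → EuclideanSpace ℝ (Fin 3)}
    (hd : 0 < d) (hη : η < 1 / 20)
    (ht : ∀ u : ↥Pat, t u ∈ S ∧ ‖(t u - p) - d • A (u : EuclideanSpace ℝ (Fin 3))‖ ≤ η * d)
    (hnn₁ : ∀ s ∈ S, s ≠ p → d ≤ dist s p) (hnn₂ : ∃ s ∈ S, s ≠ p ∧ dist s p ≤ d)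
    (hgap : ∀ s ∈ S, s ≠ p → dist s p < 13 / 10 * d + γ → dist s p ≤ 13 / 10 * d - γ ∧ s ∈ Set.range t)
    (hε0 : 0 < ε) (hεη : 100 * ε ≤ d * (1 - 20 * η)) (hεγ : 5 * ε ≤ γ) (hεδ : 4 * ε < δ) (hε7 : 4 * ε < 7 / 10)
    (hR : 2 * d + γ + 2 ≤ R)
    {dj : ℝ} (hdj : dj = sInf ((fun z => dist z (y j)) '' (Set.range y \ {y j}))) :
    ∃ e : ↥{z : EuclideanSpace ℝ (Fin 3) | z ∈ Set.range y ∧ z ≠ y j ∧ dist z (y j) < 13 / 10 * dj} ≃ ↥Pat,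
      ∀ z : ↥{z : EuclideanSpace ℝ (Fin 3) | z ∈ Set.range y ∧ z ≠ y j ∧ dist z (y j) < 13 / 10 * dj},
        dist (dj⁻¹ • ((z : EuclideanSpace ℝ (Fin 3)) - y j)) (A ((e z : ↥Pat) : EuclideanSpace ℝ (Fin 3))) ≤ 1 / 20 := by
  -- numerics
  have hηpos : 0 ≤ η := by
    obtain ⟨u₀, hu₀⟩ := hPat
    have h1 := (ht ⟨u₀, hu₀⟩).2
    have h2 : 0 ≤ ‖(t ⟨u₀, hu₀⟩ - p) - d • A ((⟨u₀, hu₀⟩ : ↥Pat) : EuclideanSpace ℝ (Fin 3))‖ := norm_nonneg _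
    nlinarith
  have hη0 : 0 ≤ 1 - 20 * η := by linarith
  have hεd : 100 * ε ≤ d := by nlinarith
  have hyj : ‖y j - y i‖ ≤ ε := by
    have := hj
    rwa [sub_self, dist_zero_right] at this
  have key : ∀ (a : Fin N) (s : EuclideanSpace ℝ (Fin 3)), dist (y a - y i) (s - p) ≤ ε →
      ‖(y a - y j) - (s - p)‖ ≤ 2 * ε := by
    intro a s h
    have hid : (y a - y j) - (s - p) = ((y a - y i) - (s - p)) + (y i - y j) := by abel
    rw [hid]
    calc ‖((y a - y i) - (s - p)) + (y i - y j)‖ ≤ ‖(y a - y i) - (s - p)‖ + ‖y i - y j‖ := norm_add_le _ _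
      _ ≤ ε + ε := add_le_add (by rw [← dist_eq_norm]; exact h) (by rw [norm_sub_rev]; exact hyj)
      _ = 2 * ε := by ring
  have htu_norm : ∀ u : ↥Pat, d * (1 - η) ≤ ‖t u - p‖ ∧ ‖t u - p‖ ≤ d * (1 + η) := by
    intro u
    have h1 := (ht u).2
    have h2 : ‖d • A (u : EuclideanSpace ℝ (Fin 3))‖ = d := by
      rw [norm_smul, Real.norm_eq_abs, abs_of_pos hd, A.norm_map, hPatn u u.2, mul_one]
    constructor
    · have h3 := norm_sub_norm_le (d • A (u : EuclideanSpace ℝ (Fin 3))) (t u - p)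
      rw [h2, norm_sub_rev (d • A (u : EuclideanSpace ℝ (Fin 3))) (t u - p)] at h3
      nlinarith
    · have h3 : ‖t u - p‖ ≤ ‖(t u - p) - d • A (u : EuclideanSpace ℝ (Fin 3))‖ + ‖d • A (u : EuclideanSpace ℝ (Fin 3))‖ := by
        calc ‖t u - p‖ = ‖((t u - p) - d • A (u : EuclideanSpace ℝ (Fin 3))) + d • A (u : EuclideanSpace ℝ (Fin 3))‖ := by
              rw [sub_add_cancel]
          _ ≤ _ := norm_add_le _ _
      rw [h2] at h3
      nlinarith
  have htu_ne : ∀ u : ↥Pat, t u ≠ p := by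
    intro u h
    have := (htu_norm u).1
    rw [h, sub_self, norm_zero] at this
    nlinarith
  have htu_sep : ∀ u u' : ↥Pat, u ≠ u' → d * (1 - 2 * η) ≤ ‖t u - t u'‖ := by
    intro u u' hne
    have h1 := (ht u).2
    have h2 := (ht u').2
    have hne' : (u : EuclideanSpace ℝ (Fin 3)) ≠ u' := fun h => hne (Subtype.ext h)
    have h3 : d ≤ ‖d • A (u : EuclideanSpace ℝ (Fin 3)) - d • A (u' : EuclideanSpace ℝ (Fin 3))‖ := by
      rw [← smul_sub, norm_smul, Real.norm_eq_abs, abs_of_pos hd, ← map_sub, A.norm_map, ← dist_eq_norm]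
      nlinarith [hPat1 u u.2 u' u'.2 hne']
    have hid : d • A (u : EuclideanSpace ℝ (Fin 3)) - d • A (u' : EuclideanSpace ℝ (Fin 3)) =
        (t u - t u') - (((t u - p) - d • A (u : EuclideanSpace ℝ (Fin 3))) - ((t u' - p) - d • A (u' : EuclideanSpace ℝ (Fin 3)))) := by abel
    rw [hid] at h3
    have h4 := norm_sub_le (t u - t u') (((t u - p) - d • A (u : EuclideanSpace ℝ (Fin 3))) - ((t u' - p) - d • A (u' : EuclideanSpace ℝ (Fin 3))))
    have h5 := norm_sub_le ((t u - p) - d • A (u : EuclideanSpace ℝ (Fin 3))) ((t u' - p) - d • A (u' : EuclideanSpace ℝ (Fin 3)))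
    nlinarith
  have t_inj : ∀ u u' : ↥Pat, ‖t u - t u'‖ ≤ 4 * ε → u = u' := by
    intro u u' h
    by_contra hne
    have := htu_sep u u' hne
    nlinarith
  have hDbdd : BddBelow ((fun z => dist z (y j)) '' (Set.range y \ {y j})) :=
    ⟨0, by rintro b ⟨z, -, rfl⟩; exact dist_nonneg⟩
  have hdj_le : ∀ a : Fin N, y a ≠ y j → dj ≤ dist (y a) (y j) :=
    fun a ha => hdj ▸ csInf_le hDbdd ⟨y a, ⟨⟨a, rfl⟩, ha⟩, rfl⟩
  have hfar : ∀ (a : Fin N) (s : EuclideanSpace ℝ (Fin 3)), s ∈ S → dist (y a - y i) (s - p) ≤ ε → y a ≠ y j → s ≠ p := by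
    intro a s hs h hne hsp
    have h1 := key a s h
    rw [hsp, sub_self, sub_zero, ← dist_eq_norm] at h1
    have : (7 : ℝ) / 10 ≤ dist (y a) (y j) := hsepY a j (fun h => hne (by rw [h]))
    linarith
  have hdj_ge : d - 2 * ε ≤ dj := by
    obtain ⟨u₀, hu₀⟩ := hPat
    -- non-emptiness of the distance set via the matched shell atom `t u₀`
    have hdη : d * (1 + η) ≤ 2 * d := by nlinarith
    obtain ⟨a₀, ha₀⟩ := hm1 (t ⟨u₀, hu₀⟩) (ht _).1 (by
      have := (htu_norm ⟨u₀, hu₀⟩).2; rw [dist_eq_norm]; linarith)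
    have ha₀j : y a₀ ≠ y j := by
      intro h
      have h1 := key a₀ _ ha₀
      rw [h, sub_self, zero_sub, norm_neg] at h1
      have h2 := (htu_norm ⟨u₀, hu₀⟩).1
      have h3 : d * (1 - η) ≥ d * (19 / 20) := by nlinarith
      linarith
    rw [hdj]
    refine le_csInf ⟨_, ⟨y a₀, ⟨⟨a₀, rfl⟩, ha₀j⟩, rfl⟩⟩ ?_
    rintro b ⟨z, ⟨⟨a, rfl⟩, hz⟩, rfl⟩
    have haj : y a ≠ y j := fun h => hz h
    by_cases haR : dist (y a) (y i) ≤ R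
    · obtain ⟨s, hs, has⟩ := hm2 a haR
      have hsp := hfar a s hs has haj
      have h1 := hnn₁ s hs hsp
      have h2 := key a s has
      have h3 : dist s p ≤ dist (y a) (y j) + 2 * ε := by
        rw [dist_eq_norm, dist_eq_norm]
        calc ‖s - p‖ = ‖(y a - y j) - ((y a - y j) - (s - p))‖ := by congr 1; abel
          _ ≤ ‖y a - y j‖ + ‖(y a - y j) - (s - p)‖ := norm_sub_le _ _
          _ ≤ ‖y a - y j‖ + 2 * ε := by linarith
      show d - 2 * ε ≤ dist (y a) (y j)
      linarith
    · push Not at haR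
      show d - 2 * ε ≤ dist (y a) (y j)
      have h1 : dist (y a) (y i) ≤ dist (y a) (y j) + dist (y j) (y i) := dist_triangle _ _ _
      rw [dist_eq_norm (y j)] at h1
      linarith
  have hdj_le' : dj ≤ d + 2 * ε := by
    obtain ⟨s₀, hs₀, hs₀p, hs₀d⟩ := hnn₂
    obtain ⟨a₀, ha₀⟩ := hm1 s₀ hs₀ (by linarith)
    have ha₀j : y a₀ ≠ y j := by
      intro h
      have h1 := key a₀ s₀ ha₀
      rw [h, sub_self, zero_sub, norm_neg, ← dist_eq_norm] at h1
      have := hS s₀ hs₀ p hp hs₀p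
      linarith
    have h1 := hdj_le a₀ ha₀j
    have h2 := key a₀ s₀ ha₀
    have h3 : dist (y a₀) (y j) ≤ dist s₀ p + 2 * ε := by
      rw [dist_eq_norm, dist_eq_norm]
      calc ‖y a₀ - y j‖ = ‖(s₀ - p) + ((y a₀ - y j) - (s₀ - p))‖ := by congr 1; abel
        _ ≤ ‖s₀ - p‖ + ‖(y a₀ - y j) - (s₀ - p)‖ := norm_add_le _ _
        _ ≤ ‖s₀ - p‖ + 2 * ε := by linarith
    linarith
  have hdjpos : 0 < dj := by linarith
  -- every shell site of `j` is matched to a shell atom `t u`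
  have hshell : ∀ z : ↥{z : EuclideanSpace ℝ (Fin 3) | z ∈ Set.range y ∧ z ≠ y j ∧ dist z (y j) < 13 / 10 * dj},
      ∃ u : ↥Pat, ‖((z : EuclideanSpace ℝ (Fin 3)) - y j) - (t u - p)‖ ≤ 2 * ε := by
    intro z
    obtain ⟨⟨a, ha⟩, hne, hlt⟩ := z.2
    have haR : dist (y a) (y i) ≤ R := by
      have h1 : dist (y a) (y i) ≤ dist (y a) (y j) + dist (y j) (y i) := dist_triangle _ _ _
      rw [dist_eq_norm (y j)] at h1
      rw [ha] at h1 ⊢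
      have hlt' : dist (z : EuclideanSpace ℝ (Fin 3)) (y j) < 13 / 10 * dj := hlt
      nlinarith
    obtain ⟨s, hs, has⟩ := hm2 a haR
    have haj : y a ≠ y j := by rw [ha]; exact hne
    have hsp := hfar a s hs has haj
    have h2 := key a s has
    rw [ha] at h2
    have h3 : dist s p < 13 / 10 * d + γ := by
      have hlt' : dist (z : EuclideanSpace ℝ (Fin 3)) (y j) < 13 / 10 * dj := hlt
      rw [dist_eq_norm] at hlt' ⊢
      calc ‖s - p‖ = ‖((z : EuclideanSpace ℝ (Fin 3)) - y j) - (((z : EuclideanSpace ℝ (Fin 3)) - y j) - (s - p))‖ := by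
            congr 1; abel
        _ ≤ ‖(z : EuclideanSpace ℝ (Fin 3)) - y j‖ + ‖((z : EuclideanSpace ℝ (Fin 3)) - y j) - (s - p)‖ := norm_sub_le _ _
        _ < 13 / 10 * dj + 2 * ε := by linarith
        _ ≤ 13 / 10 * d + γ := by nlinarith
    obtain ⟨-, ⟨u, hu⟩⟩ := hgap s hs hsp h3
    exact ⟨u, by rw [hu]; exact h2⟩
  choose f hf using hshell
  have f_inj : Function.Injective f := by
    intro z z' h
    have h1 := hf z
    have h2 := hf z'
    rw [h] at h1
    obtain ⟨⟨a, ha⟩, -, -⟩ := z.2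
    obtain ⟨⟨a', ha'⟩, -, -⟩ := z'.2
    apply Subtype.ext
    rw [← ha, ← ha']
    by_contra hne
    have haa : a ≠ a' := fun h => hne (by rw [h])
    have h3 := hsepY a a' haa
    rw [dist_eq_norm] at h3
    have h4 : ‖y a - y a'‖ ≤ 2 * ε + 2 * ε := by
      calc ‖y a - y a'‖ = ‖(((z : EuclideanSpace ℝ (Fin 3)) - y j) - (t (f z') - p)) - (((z' : EuclideanSpace ℝ (Fin 3)) - y j) - (t (f z') - p))‖ := by
            rw [ha, ha']; congr 1; abel
        _ ≤ _ := norm_sub_le _ _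
        _ ≤ 2 * ε + 2 * ε := add_le_add h1 h2
    linarith
  have f_surj : Function.Surjective f := by
    intro u
    have hdη : d * (1 + η) ≤ 2 * d := by nlinarith
    obtain ⟨a, ha⟩ := hm1 (t u) (ht u).1 (by
      have := (htu_norm u).2; rw [dist_eq_norm]; linarith)
    have h2 := key a _ ha
    have haj : y a ≠ y j := by
      intro h
      rw [h, sub_self, zero_sub, norm_neg] at h2
      have h3 := (htu_norm u).1
      have h4 : d * (1 - η) ≥ d * (19 / 20) := by nlinarith
      linarith
    have halt : dist (y a) (y j) < 13 / 10 * dj := by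
      rw [dist_eq_norm]
      calc ‖y a - y j‖ = ‖(t u - p) + ((y a - y j) - (t u - p))‖ := by congr 1; abel
        _ ≤ ‖t u - p‖ + ‖(y a - y j) - (t u - p)‖ := norm_add_le _ _
        _ ≤ d * (1 + η) + 2 * ε := add_le_add (htu_norm u).2 h2
        _ < 13 / 10 * dj := by
            have : d * η < d * (1 / 20) := mul_lt_mul_of_pos_left hη hd
            linarith
    refine ⟨⟨y a, ⟨a, rfl⟩, haj, halt⟩, ?_⟩
    apply t_inj
    have h3 := hf ⟨y a, ⟨a, rfl⟩, haj, halt⟩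
    calc ‖t (f ⟨y a, ⟨a, rfl⟩, haj, halt⟩) - t u‖
        = ‖((y a - y j) - (t u - p)) - ((y a - y j) - (t (f ⟨y a, ⟨a, rfl⟩, haj, halt⟩) - p))‖ := by congr 1; abel
      _ ≤ ‖(y a - y j) - (t u - p)‖ + ‖(y a - y j) - (t (f ⟨y a, ⟨a, rfl⟩, haj, halt⟩) - p)‖ := norm_sub_le _ _
      _ ≤ 2 * ε + 2 * ε := add_le_add h2 h3
      _ = 4 * ε := by ring
  refine ⟨Equiv.ofBijective f ⟨f_inj, f_surj⟩, fun z => ?_⟩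
  rw [Equiv.ofBijective_apply]
  have h1 := hf z
  have h2 := (ht (f z)).2
  have h3 : ‖d • A ((f z : ↥Pat) : EuclideanSpace ℝ (Fin 3)) - dj • A ((f z : ↥Pat) : EuclideanSpace ℝ (Fin 3))‖ ≤ 2 * ε := by
    rw [← sub_smul, norm_smul, A.norm_map, hPatn _ (f z).2, mul_one, Real.norm_eq_abs, abs_le]
    constructor <;> linarith
  have h4 : ‖((z : EuclideanSpace ℝ (Fin 3)) - y j) - dj • A ((f z : ↥Pat) : EuclideanSpace ℝ (Fin 3))‖ ≤ η * d + 4 * ε := by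
    calc ‖((z : EuclideanSpace ℝ (Fin 3)) - y j) - dj • A ((f z : ↥Pat) : EuclideanSpace ℝ (Fin 3))‖
        = ‖(((z : EuclideanSpace ℝ (Fin 3)) - y j) - (t (f z) - p)) + ((t (f z) - p) - d • A ((f z : ↥Pat) : EuclideanSpace ℝ (Fin 3))) +
            (d • A ((f z : ↥Pat) : EuclideanSpace ℝ (Fin 3)) - dj • A ((f z : ↥Pat) : EuclideanSpace ℝ (Fin 3)))‖ := by congr 1; abel
      _ ≤ ‖((z : EuclideanSpace ℝ (Fin 3)) - y j) - (t (f z) - p)‖ + ‖(t (f z) - p) - d • A ((f z : ↥Pat) : EuclideanSpace ℝ (Fin 3))‖ +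
            ‖d • A ((f z : ↥Pat) : EuclideanSpace ℝ (Fin 3)) - dj • A ((f z : ↥Pat) : EuclideanSpace ℝ (Fin 3))‖ := norm_add₃_le
      _ ≤ 2 * ε + η * d + 2 * ε := add_le_add (add_le_add h1 h2) h3
      _ = η * d + 4 * ε := by ring
  have h5 : dist (dj⁻¹ • ((z : EuclideanSpace ℝ (Fin 3)) - y j)) (A ((f z : ↥Pat) : EuclideanSpace ℝ (Fin 3))) =
      dj⁻¹ * ‖((z : EuclideanSpace ℝ (Fin 3)) - y j) - dj • A ((f z : ↥Pat) : EuclideanSpace ℝ (Fin 3))‖ := by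
    rw [norm_sub_smul_eq hdjpos, ← mul_assoc, inv_mul_cancel₀ hdjpos.ne', one_mul]
  rw [h5, inv_mul_le_iff₀ hdjpos]
  nlinarith

/-- **No atom of a texture-charged configuration is robustly good (deterministic).**  Let `μ = count|S` be a rooted
`δ`-hard-core configuration (`δ > 0`), texture-charged in the sense of clause (d) of the crux (only the separation of the
approximants, their clause (2) «every site of the `R`-ball is `1/20`-bad» and the two matching clauses are assumed), and
`p` an atom.  Then for no scale `d > 0`, tolerance `η < 1/20`, gap `γ > 0`, linear isometry `A` and shell assignment
`t : pattern → ℝ³` do the following hold together: every `t u` is an atom with `‖(t u − p) − d•A u‖ ≤ η·d`; `d` is the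
nearest-neighbour distance of `p` (`d ≤ dist s p` for every atom `s ≠ p`, with equality attained up to `≤`); and the
shell sphere is clean (every atom `s ≠ p` with `dist s p < 13/10·d + γ` has `dist s p ≤ 13/10·d − γ` and is some `t u`) —
for the fcc pattern, and for the hcp pattern.  Proof: match the ball of radius `2d + γ + 2` around `p` with a small
tolerance; clause (2) at the site matched to `p` contradicts `good_transfer_core`. [folklore] -/
theorem not_robustGood_of_texture {δ : ℝ} (hδ : 0 < δ) {μ : Measure (EuclideanSpace ℝ (Fin 3))}
    (hμ : IsRootedHardCore δ μ)
    (h : ∀ q : EuclideanSpace ℝ (Fin 3), μ {q} ≠ 0 → ∀ R ε : ℝ, 0 < ε → ∃ (N : ℕ) (y : Fin N → EuclideanSpace ℝ (Fin 3)) (i : Fin N),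
      (∀ a b : Fin N, a ≠ b → (7 : ℝ) / 10 ≤ dist (y a) (y b)) ∧
      (∀ j : Fin N, dist (y j) (y i) ≤ R → ¬ ∃ A : EuclideanSpace ℝ (Fin 3) →ₗᵢ[ℝ] EuclideanSpace ℝ (Fin 3),
          (∃ e : ↥{z : EuclideanSpace ℝ (Fin 3) | z ∈ Set.range y ∧ z ≠ y j ∧ dist z (y j) < 13 / 10 * sInf ((fun z => dist z (y j)) '' (Set.range y \ {y j}))} ≃ ↥Literature.Geometry.DiscreteGeometry.fccKissingPattern, ∀ t : ↥{z : EuclideanSpace ℝ (Fin 3) | z ∈ Set.range y ∧ z ≠ y j ∧ dist z (y j) < 13 / 10 * sInf ((fun z => dist z (y j)) '' (Set.range y \ {y j}))}, dist ((sInf ((fun z => dist z (y j)) '' (Set.range y \ {y j})))⁻¹ • ((t : EuclideanSpace ℝ (Fin 3)) - y j)) (A ((e t : ↥Literature.Geometry.DiscreteGeometry.fccKissingPattern) : EuclideanSpace ℝ (Fin 3))) ≤ 1 / 20) ∨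
          (∃ e : ↥{z : EuclideanSpace ℝ (Fin 3) | z ∈ Set.range y ∧ z ≠ y j ∧ dist z (y j) < 13 / 10 * sInf ((fun z => dist z (y j)) '' (Set.range y \ {y j}))} ≃ ↥Literature.Geometry.DiscreteGeometry.hcpKissingPattern, ∀ t : ↥{z : EuclideanSpace ℝ (Fin 3) | z ∈ Set.range y ∧ z ≠ y j ∧ dist z (y j) < 13 / 10 * sInf ((fun z => dist z (y j)) '' (Set.range y \ {y j}))}, dist ((sInf ((fun z => dist z (y j)) '' (Set.range y \ {y j})))⁻¹ • ((t : EuclideanSpace ℝ (Fin 3)) - y j)) (A ((e t : ↥Literature.Geometry.DiscreteGeometry.hcpKissingPattern) : EuclideanSpace ℝ (Fin 3))) ≤ 1 / 20)) ∧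
      (∀ s : EuclideanSpace ℝ (Fin 3), μ {s} ≠ 0 → dist s q ≤ R → ∃ a : Fin N, dist (y a - y i) (s - q) ≤ ε) ∧
      (∀ a : Fin N, dist (y a) (y i) ≤ R → ∃ s : EuclideanSpace ℝ (Fin 3), μ {s} ≠ 0 ∧ dist (y a - y i) (s - q) ≤ ε))
    {p : EuclideanSpace ℝ (Fin 3)} (hp : μ {p} ≠ 0) (d η γ : ℝ)
    (A : EuclideanSpace ℝ (Fin 3) →ₗᵢ[ℝ] EuclideanSpace ℝ (Fin 3)) :
    (∀ t : ↥Literature.Geometry.DiscreteGeometry.fccKissingPattern → EuclideanSpace ℝ (Fin 3),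
      ¬ (0 < d ∧ 0 < γ ∧ η < 1 / 20 ∧
        (∀ u : ↥Literature.Geometry.DiscreteGeometry.fccKissingPattern, μ {t u} ≠ 0 ∧ ‖(t u - p) - d • A (u : EuclideanSpace ℝ (Fin 3))‖ ≤ η * d) ∧
        (∀ s : EuclideanSpace ℝ (Fin 3), μ {s} ≠ 0 → s ≠ p → d ≤ dist s p) ∧
        (∃ s : EuclideanSpace ℝ (Fin 3), μ {s} ≠ 0 ∧ s ≠ p ∧ dist s p ≤ d) ∧
        (∀ s : EuclideanSpace ℝ (Fin 3), μ {s} ≠ 0 → s ≠ p → dist s p < 13 / 10 * d + γ → dist s p ≤ 13 / 10 * d - γ ∧ s ∈ Set.range t))) ∧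
    (∀ t : ↥Literature.Geometry.DiscreteGeometry.hcpKissingPattern → EuclideanSpace ℝ (Fin 3),
      ¬ (0 < d ∧ 0 < γ ∧ η < 1 / 20 ∧
        (∀ u : ↥Literature.Geometry.DiscreteGeometry.hcpKissingPattern, μ {t u} ≠ 0 ∧ ‖(t u - p) - d • A (u : EuclideanSpace ℝ (Fin 3))‖ ≤ η * d) ∧
        (∀ s : EuclideanSpace ℝ (Fin 3), μ {s} ≠ 0 → s ≠ p → d ≤ dist s p) ∧
        (∃ s : EuclideanSpace ℝ (Fin 3), μ {s} ≠ 0 ∧ s ≠ p ∧ dist s p ≤ d) ∧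
        (∀ s : EuclideanSpace ℝ (Fin 3), μ {s} ≠ 0 → s ≠ p → dist s p < 13 / 10 * d + γ → dist s p ≤ 13 / 10 * d - γ ∧ s ∈ Set.range t))) := by
  obtain ⟨S, -, hS, hμS⟩ := hμ
  have hmem : ∀ q : EuclideanSpace ℝ (Fin 3), μ {q} ≠ 0 ↔ q ∈ S := fun q => by
    rw [hμS]; exact count_restrict_singleton_ne_zero_iff S q
  have hpS : p ∈ S := (hmem p).1 hp
  -- the common contradiction, for a pattern of unit vectors pairwise `≥ 1` apart which is fcc or hcp
  have main : ∀ (Pat : Finset (EuclideanSpace ℝ (Fin 3))), Pat.Nonempty → (∀ u ∈ Pat, ‖u‖ = 1) →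
      (∀ u ∈ Pat, ∀ u' ∈ Pat, u ≠ u' → 1 ≤ dist u u') →
      (Pat = Literature.Geometry.DiscreteGeometry.fccKissingPattern ∨ Pat = Literature.Geometry.DiscreteGeometry.hcpKissingPattern) →
      ∀ t : ↥Pat → EuclideanSpace ℝ (Fin 3),
      ¬ (0 < d ∧ 0 < γ ∧ η < 1 / 20 ∧
        (∀ u : ↥Pat, μ {t u} ≠ 0 ∧ ‖(t u - p) - d • A (u : EuclideanSpace ℝ (Fin 3))‖ ≤ η * d) ∧
        (∀ s : EuclideanSpace ℝ (Fin 3), μ {s} ≠ 0 → s ≠ p → d ≤ dist s p) ∧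
        (∃ s : EuclideanSpace ℝ (Fin 3), μ {s} ≠ 0 ∧ s ≠ p ∧ dist s p ≤ d) ∧
        (∀ s : EuclideanSpace ℝ (Fin 3), μ {s} ≠ 0 → s ≠ p → dist s p < 13 / 10 * d + γ → dist s p ≤ 13 / 10 * d - γ ∧ s ∈ Set.range t)) := by
    intro Pat hPat hPatn hPat1 hwhich t
    rintro ⟨hd, hγ, hη, ht, hnn₁, hnn₂, hgap⟩
    have hη0 : 0 < 1 - 20 * η := by linarith
    -- tolerance and radius
    set ε : ℝ := min (min (min (d * (1 - 20 * η) / 100) (γ / 5)) (δ / 5)) (1 / 10) with hε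
    have hε0 : 0 < ε := lt_min (lt_min (lt_min (by positivity) (by linarith)) (by linarith)) (by norm_num)
    have hεη : ε ≤ d * (1 - 20 * η) / 100 := ((min_le_left _ _).trans (min_le_left _ _)).trans (min_le_left _ _)
    have hεγ : ε ≤ γ / 5 := ((min_le_left _ _).trans (min_le_left _ _)).trans (min_le_right _ _)
    have hεδ : ε ≤ δ / 5 := (min_le_left _ _).trans (min_le_right _ _)
    have hε10 : ε ≤ 1 / 10 := min_le_right _ _
    have hR0 : (0 : ℝ) ≤ 2 * d + γ + 2 := by positivity
    obtain ⟨N, y, i, hsepY, hcl2, hm1, hm2⟩ := h p hp (2 * d + γ + 2) ε hε0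
    have hm1' : ∀ s ∈ S, dist s p ≤ 2 * d + γ + 2 → ∃ a : Fin N, dist (y a - y i) (s - p) ≤ ε :=
      fun s hs => hm1 s ((hmem s).2 hs)
    have hm2' : ∀ a : Fin N, dist (y a) (y i) ≤ 2 * d + γ + 2 → ∃ s ∈ S, dist (y a - y i) (s - p) ≤ ε := fun a ha => by
      obtain ⟨s, hs, h⟩ := hm2 a ha
      exact ⟨s, (hmem s).1 hs, h⟩
    -- the site matched to `p`
    obtain ⟨j, hj⟩ := hm1' p hpS (by rw [dist_self]; exact hR0)
    have hjR : dist (y j) (y i) ≤ 2 * d + γ + 2 := by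
      have h1 : dist (y j) (y i) ≤ ε := by
        have h2 := hj
        rwa [sub_self, dist_zero_right, ← dist_eq_norm] at h2
      linarith
    have hbad := hcl2 j hjR
    set dj : ℝ := sInf ((fun z => dist z (y j)) '' (Set.range y \ {y j})) with hdj
    have ht' : ∀ u : ↥Pat, t u ∈ S ∧ ‖(t u - p) - d • A (u : EuclideanSpace ℝ (Fin 3))‖ ≤ η * d :=
      fun u => ⟨(hmem _).1 (ht u).1, (ht u).2⟩
    have hnn₁' : ∀ s ∈ S, s ≠ p → d ≤ dist s p := fun s hs => hnn₁ s ((hmem s).2 hs)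
    have hnn₂' : ∃ s ∈ S, s ≠ p ∧ dist s p ≤ d := by
      obtain ⟨s, hs, h1, h2⟩ := hnn₂
      exact ⟨s, (hmem s).1 hs, h1, h2⟩
    have hgap' : ∀ s ∈ S, s ≠ p → dist s p < 13 / 10 * d + γ → dist s p ≤ 13 / 10 * d - γ ∧ s ∈ Set.range t :=
      fun s hs => hgap s ((hmem s).2 hs)
    obtain ⟨e, he⟩ := good_transfer_core hS hsepY hm1' hm2' hpS hj hPat hPatn hPat1 hd hη ht' hnn₁' hnn₂' hgap'
      hε0 (by linarith) (by linarith) (by linarith) (by linarith) le_rfl hdj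
    rcases hwhich with rfl | rfl
    · exact hbad ⟨A, Or.inl ⟨e, he⟩⟩
    · exact hbad ⟨A, Or.inr ⟨e, he⟩⟩
  exact ⟨main _ fccKissingPattern_nonempty (fun u hu => norm_eq_one_of_mem_fccKissingPattern hu)
      (fun u hu u' hu' hne => one_le_dist_of_mem_fccKissingPattern hu hu' hne) (Or.inl rfl),
    main _ hcpKissingPattern_nonempty (fun u hu => norm_eq_one_of_mem_hcpKissingPattern hu)
      (fun u hu u' hu' hne => one_le_dist_of_mem_hcpKissingPattern hu hu' hne) (Or.inr rfl)⟩

/-- **Clauses (a) + (d) of the crux ⟹ almost surely no atom is robustly good** (law level, the crux's `let`-bound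
`Gy` / `TexBall` / `Appr` VERBATIM): for every `δ > 0`, every law `P` with `P`-a.s. rooted `δ`-hard-core configurations
and every choice of texture radii with `P`-a.s. `Appr μ R₇ R₈ R₉`, `P`-almost surely every atom `p` fails, for every
scale / tolerance `< 1/20` / shell gap / isometry / shell assignment, to be robustly fcc-good and to be robustly hcp-good
(`not_robustGood_of_texture`). [folklore] -/
theorem ae_not_robustGood_of_texture :
    ∀ P : MeasureTheory.Measure (MeasureTheory.Measure (EuclideanSpace ℝ (Fin 3))), let Gy : ℝ → (N : ℕ) → (Fin N → EuclideanSpace ℝ (Fin 3)) → Fin N → Prop := fun η N y j => let d : ℝ := sInf ((fun z => dist z (y (j : Fin N))) '' (Set.range (y) \ {(y (j : Fin N))})); let T : Set (EuclideanSpace ℝ (Fin 3)) := {z : EuclideanSpace ℝ (Fin 3) | z ∈ Set.range (y) ∧ z ≠ (y (j : Fin N)) ∧ dist z (y (j : Fin N)) < 13 / 10 * d}; ∃ A : EuclideanSpace ℝ (Fin 3) →ₗᵢ[ℝ] EuclideanSpace ℝ (Fin 3), (∃ e : ↥T ≃ ↥Literature.Geometry.DiscreteGeometry.fccKissingPattern,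 ∀ t : ↥T, dist (d⁻¹ • ((t : EuclideanSpace ℝ (Fin 3)) - (y (j : Fin N)))) (A ((e t : ↥Literature.Geometry.DiscreteGeometry.fccKissingPattern) : EuclideanSpace ℝ (Fin 3))) ≤ η) ∨ (∃ e : ↥T ≃ ↥Literature.Geometry.DiscreteGeometry.hcpKissingPattern, ∀ t : ↥T, dist (d⁻¹ • ((t : EuclideanSpace ℝ (Fin 3)) - (y (j : Fin N)))) (A ((e t : ↥Literature.Geometry.DiscreteGeometry.hcpKissingPattern) : EuclideanSpace ℝ (Fin 3))) ≤ η); let TexBall : (N : ℕ) → (Fin N → EuclideanSpace ℝ (Fin 3)) → Fin N → ℝ → ℝ → ℝ → ℝ → Prop := fun N y i R R₇ R₈ R₉ => (∀ a b : Fin N, a ≠ b → (7 : ℝ) / 10 ≤ dist (y a) (y b)) ∧ (∀ j : Fin N, dist (y j) (y i) ≤ R → ¬ Gy (1 / 20) N (y) j) ∧ (∀ j : Fin N, dist (y j) (y i) ≤ R → ¬ ((∀ j' : Fin N, dist (y j') (y j) ≤ R₇ → ¬ Gy (1 / 20) N (y) j') ∧ (∀ z : EuclideanSpace ℝ (Fin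 3), dist z (y j) ≤ R₇ → ∃ k : Fin N, dist z (y k) ≤ 1) ∧ (∀ j' : Fin N, dist (y j') (y j) ≤ R₇ → (let d : ℝ := sInf ((fun z => dist z (y j')) '' (Set.range (y) \ {(y j')})); ∀ k : Fin N, y k ≠ y j' → dist (y k) (y j') < 27 / 20 * d → 5 ≤ Nat.card {m : Fin N // y m ≠ y j' ∧ dist (y m) (y j') < 27 / 20 * d ∧ y m ≠ y k ∧ dist (y m) (y k) < 27 / 20 * d})))) ∧ (∀ j : Fin N, dist (y j) (y i) ≤ R → ∃ k : Fin N, dist (y k) (y j) ≤ R₈ ∧ Gy (1 / 8) N (y) k) ∧ (∀ j : Fin N, dist (y j) (y i) ≤ R → ¬ ((∀ j' : Fin N, dist (y j') (y j) ≤ R₉ → ¬ Gy (1 / 20) N (y) j') ∧ (Nat.card {j' : Fin N // dist (y j') (y j) ≤ R₉ ∧ ¬ Gy (1 / 8) N (y) j'} : ℝ) ≤ 1 / 2 * (Nat.card {j' : Fin N // dist (y j') (y j) ≤ R₉} : ℝ) ∧ (∀ j' : Fin N, dist (y j') (y j) ≤ R₉ → ¬ Gy (1 / 8) N (y) j' →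 ¬ (let d : ℝ := sInf ((fun z => dist z (y j')) '' (Set.range (y) \ {(y j')})); ∀ k : Fin N, y k ≠ y j' → dist (y k) (y j') < 27 / 20 * d → 5 ≤ Nat.card {m : Fin N // y m ≠ y j' ∧ dist (y m) (y j') < 27 / 20 * d ∧ y m ≠ y k ∧ dist (y m) (y k) < 27 / 20 * d})))); let Appr : MeasureTheory.Measure (EuclideanSpace ℝ (Fin 3)) → ℝ → ℝ → ℝ → Prop := fun μ R₇ R₈ R₉ => ∀ q : EuclideanSpace ℝ (Fin 3), μ {q} ≠ 0 → ∀ R ε : ℝ, 0 < ε → ∃ (N : ℕ) (y : Fin N → EuclideanSpace ℝ (Fin 3)) (i : Fin N), TexBall N y i R R₇ R₈ R₉ ∧ (∀ p : EuclideanSpace ℝ (Fin 3), μ {p} ≠ 0 → dist p q ≤ R → ∃ k : Fin N, dist (y k - y i) (p - q) ≤ ε) ∧ (∀ k : Fin N, dist (y k) (y i) ≤ R → ∃ p : EuclideanSpace ℝ (Fin 3), μ {p} ≠ 0 ∧ dist (y k - y i) (p - q) ≤ ε);  ∀ δ : ℝ, 0 < δ → (∀ᵐ μ ∂P, Literature.Probability.Process.IsRootedHardCore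 δ μ) → ∀ R₇ R₈ R₉ : ℝ, (∀ᵐ μ ∂P, Appr μ R₇ R₈ R₉) →
      ∀ᵐ μ ∂P, ∀ p : EuclideanSpace ℝ (Fin 3), μ {p} ≠ 0 → ∀ (d η γ : ℝ) (A : EuclideanSpace ℝ (Fin 3) →ₗᵢ[ℝ] EuclideanSpace ℝ (Fin 3)),
        (∀ t : ↥Literature.Geometry.DiscreteGeometry.fccKissingPattern → EuclideanSpace ℝ (Fin 3),
          ¬ (0 < d ∧ 0 < γ ∧ η < 1 / 20 ∧
            (∀ u : ↥Literature.Geometry.DiscreteGeometry.fccKissingPattern, μ {t u} ≠ 0 ∧ ‖(t u - p) - d • A (u : EuclideanSpace ℝ (Fin 3))‖ ≤ η * d) ∧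
            (∀ s : EuclideanSpace ℝ (Fin 3), μ {s} ≠ 0 → s ≠ p → d ≤ dist s p) ∧
            (∃ s : EuclideanSpace ℝ (Fin 3), μ {s} ≠ 0 ∧ s ≠ p ∧ dist s p ≤ d) ∧
            (∀ s : EuclideanSpace ℝ (Fin 3), μ {s} ≠ 0 → s ≠ p → dist s p < 13 / 10 * d + γ → dist s p ≤ 13 / 10 * d - γ ∧ s ∈ Set.range t))) ∧
        (∀ t : ↥Literature.Geometry.DiscreteGeometry.hcpKissingPattern → EuclideanSpace ℝ (Fin 3),
          ¬ (0 < d ∧ 0 < γ ∧ η < 1 / 20 ∧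
            (∀ u : ↥Literature.Geometry.DiscreteGeometry.hcpKissingPattern, μ {t u} ≠ 0 ∧ ‖(t u - p) - d • A (u : EuclideanSpace ℝ (Fin 3))‖ ≤ η * d) ∧
            (∀ s : EuclideanSpace ℝ (Fin 3), μ {s} ≠ 0 → s ≠ p → d ≤ dist s p) ∧
            (∃ s : EuclideanSpace ℝ (Fin 3), μ {s} ≠ 0 ∧ s ≠ p ∧ dist s p ≤ d) ∧
            (∀ s : EuclideanSpace ℝ (Fin 3), μ {s} ≠ 0 → s ≠ p → dist s p < 13 / 10 * d + γ → dist s p ≤ 13 / 10 * d - γ ∧ s ∈ Set.range t))) := by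
  intro P
  dsimp only
  intro δ hδ ha R₇ R₈ R₉ hd
  filter_upwards [ha, hd] with μ hμ hμ' p hp d η γ A
  refine not_robustGood_of_texture hδ hμ (fun q hq R ε hε => ?_) hp d η γ A
  obtain ⟨N, y, i, ⟨hsep, h2, -, -, -⟩, hm1, hm2⟩ := hμ' q hq R ε hε
  exact ⟨N, y, i, hsep, h2, hm1, hm2⟩

end Summit.AtomisticToContinuum.Crystallization.Theorems.FrustratedLawDichotomyTextureAllBad

end
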